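import Summits.Langlands.Langlands.Theorems.PicardMuOrdinaryMuOrdinaryFamilyRTCharZeroDefs
import Summits.Langlands.Langlands.Theorems.PicardMuOrdinaryMuOrdinaryFamilyRTPointAbsIrr
import Summits.Langlands.Langlands.Theorems.PicardMuOrdinaryMuOrdinaryFamilyRTThorneAdequateTransport
import Literature.NumberTheory.GaloisRepresentations.AdequacyDegreeP
import Literature.NumberTheory.GaloisRepresentations.ExtendedAdequateSubgroup
import Literature.NumberTheory.NumberFields.EisensteinField
import Literature.RepresentationTheory.Semisimple.BurnsideMatrixSpan
import HarnessLib

/-!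
# Crux `MuOrdinaryFamilyRT` (stmt-Langlands-13757), line `thorne-minimal-lift`:
# the image of the residual heart is adequate in the extended sense (helper `rbarExtendedAdequate_of`)

Registered helper of `stub_finiteOverWeights` (its input `RbarExtendedAdequate` of `…ThorneDebts`),
CONDITIONAL on the tree's named fact `ght2017_adequate_or_index_p_or_psl29` (Guralnick–Herzig–Tiep,
JEMS 19 (2017) Thm 1.7, `AdequacyDegreeP.lean`).  For a generic quartic `f` whose discriminant lies
neither in `ℚ^{×2}` nor in `−3ℚ^{×2}` and any basis `B` of the heart, the image of
`r̄_f^B : Γ_K → GL₃(𝔽₃)` (`K = ℚ(ζ₃)`) is extended-adequate (`Subgroup.IsExtendedAdequate`, GHT §1 =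
Thorne, Math. Z. 285 (2017) Def. 2.20 — hypothesis (ii) of Thorne's Thm 5.1):

* § 1 `isSquare_or_of_isSquare_ratCast` — a rational number which is a square in `K = ℚ(√−3)` lies in
  `ℚ² ∪ (−3)ℚ²` (coordinates in the tree's model `K3 = ℚ[ω]/(ω²+ω+1)` of the third cyclotomic field,
  `IsCyclotomicExtension.algEquiv`);
* § 2 `range_toPermHom_eq_top` — **`Gal` acts on the four roots through ALL of `S₄`**: if every
  `σ ∈ Γ_K` permuted the roots evenly, `δ = ∏_{i<j}(αⱼ − αᵢ)` would be `Γ_K`-fixed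
  (`prodPairs_comp_perm`: a permutation multiplies `δ` by its sign), hence in `K` (infinite Galois
  theory of `K̄/K`, `InfiniteGalois.mem_range_algebraMap_iff_fixed`), so `disc f = lc(f)⁶ δ²`
  (`cast_discr_eq`) would be a square in `K`, against § 1 and the two hypotheses; with the tree's
  `alternatingGroup_le_range_toPermHom` (`A₄ ⊆` image) one odd element gives the whole of `S₄`;
* § 3 `exists_rbar_eq_comp_toPermHom` — `r̄_f^B` factors through the permutation action
  (`Sym(Roots f) → GL₃(𝔽₃)`, the heart of the symmetric group; by `rfl`), so its image is the image of `S₄`;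
  `index_ne_three_of_normal` — a symmetric group has no normal subgroup of index `3` (transpositions
  have order `2` and generate, `Equiv.Perm.closure_isSwap`);
* § 4 `rbarExtendedAdequate_of` — GHT Thm 1.7 (through `ght_univ_zero` of
  `…ThorneAdequateTransport`, which instantiates the universe-polymorphic fact at level `0`) applied
  to the inclusion of the image: absolutely irreducible by `FreeSeedSmoothRt.rbarAbsIrreducible`
  (Burnside span form `span_rbar_eq_top`); alternative (b) is excluded by § 3 (pull the subgroup back
  to `S₄`), alternative (c) (`PSL₂(9) ≅ A₆`, order `360`) because the image has order `≤ 24`.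
-/

-- `Summit.Langlands.Langlands.…` (summit = sub-problem name, D-0017 layout) trips `dupNamespace` on every decl.
set_option linter.dupNamespace false

namespace Summit.Langlands.Langlands.Cruxes.MuOrdinaryFamilyRT.ThorneMinimalLift

open scoped NumberField Polynomial Matrix Classical
open Field IsDedekindDomain Polynomial
open Literature.NumberTheory.GaloisRepresentations Literature.NumberTheory.Automorphic
open Literature.RepresentationTheory.Semisimple
open Summit.Langlands.Langlands.Cruxes.MuOrdinaryFamilyRT.CharZeroDominance
open Summit.Langlands.Langlands.Theorems.ResidualAutomorphyEven (prodPairs prodPairs_comp_perm map_prodPairs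
  discr_map_of_injective)

noncomputable section

/-! ## 1. Rational squares in `K = ℚ(√−3)` -/

/-- **A rational number which is a square in `K = ℚ(ζ₃)` is a square or `−3` times a square in `ℚ`.**
(In the model `K3 = ℚ[ω]`, `(a + bω)² = (a² − b²) + (2ab − b²)ω`; a rational square has
`b(2a − b) = 0`.) -/
theorem isSquare_or_of_isSquare_ratCast (D : ℚ) (h : IsSquare ((D : ℚ) : K)) :
    IsSquare D ∨ IsSquare (-3 * D) := by
  haveI := FreeSeedSmoothRt.isCyclotomicExtensionK
  obtain ⟨d, hd⟩ := h
  let ι : K ≃ₐ[ℚ] Literature.NumberTheory.NumberFields.K3 :=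
    IsCyclotomicExtension.algEquiv {3} ℚ K Literature.NumberTheory.NumberFields.K3
  have hd' : ((D : ℚ) : Literature.NumberTheory.NumberFields.K3) = ι d * ι d := by
    rw [← map_ratCast ι D, hd, map_mul]
  have hre := congrArg QuadraticAlgebra.re hd'
  have him := congrArg QuadraticAlgebra.im hd'
  rw [Literature.NumberTheory.NumberFields.K3.ratCast_re] at hre
  rw [Literature.NumberTheory.NumberFields.K3.ratCast_im] at him
  simp only [QuadraticAlgebra.re_mul, QuadraticAlgebra.im_mul] at hre him
  set a := (ι d).re
  set b := (ι d).im
  have hb : b * (2 * a - b) = 0 := by linear_combination -him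
  rcases mul_eq_zero.1 hb with hb0 | hb2
  · left
    exact ⟨a, by rw [hre, hb0]; ring⟩
  · right
    have hb' : b = 2 * a := by linear_combination -hb2
    exact ⟨3 * a, by rw [hre, hb']; ring⟩

/-! ## 2. The Galois group of `f` over `K` is the full symmetric group of the roots -/

section Galois

variable {f : ℤ[X]} (hgen : Generic f)
include hgen

/-- **If every `σ ∈ Γ_K` permutes the roots evenly, `disc f` is a square in `K`.**  The Vandermonde
product `δ = ∏_{i<j}(αⱼ − αᵢ)` of the four roots is then `Γ_K`-fixed, hence in `K`, and
`disc f = lc(f)⁶ δ²`. -/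
theorem isSquare_discr_of_forall_sign_eq_one
    (h : ∀ σ : absoluteGaloisGroup K,
      Equiv.Perm.sign (MulAction.toPermHom (absoluteGaloisGroup K) (Roots f) σ) = 1) :
    IsSquare ((f.discr : ℤ) : K) := by
  let ε := FreeSeedSmoothRt.rootEnum hgen
  let y : Fin 4 → AlgebraicClosure K := fun i => ((ε i : Roots f) : AlgebraicClosure K)
  -- `δ = prodPairs y` is fixed by `Γ_K`
  have hfix : ∀ σ : absoluteGaloisGroup K, σ • prodPairs y = prodPairs y := by
    intro σ
    set P := MulAction.toPermHom (absoluteGaloisGroup K) (Roots f) σ with hP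
    let π : Equiv.Perm (Fin 4) := ε.symm.permCongr P
    have hπ : Equiv.Perm.sign π = 1 := by rw [Equiv.Perm.sign_permCongr]; exact h σ
    have hy : (MulSemiringAction.toRingHom (absoluteGaloisGroup K) (AlgebraicClosure K) σ) ∘ y = y ∘ π := by
      funext i
      simp only [Function.comp_apply, MulSemiringAction.toRingHom_apply]
      change σ • ((ε i : Roots f) : AlgebraicClosure K) =
        ((ε (ε.symm.permCongr P i) : Roots f) : AlgebraicClosure K)
      rw [Equiv.permCongr_apply, Equiv.symm_symm, Equiv.apply_symm_apply]
      rfl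
    calc σ • prodPairs y
        = MulSemiringAction.toRingHom (absoluteGaloisGroup K) (AlgebraicClosure K) σ (prodPairs y) :=
          (MulSemiringAction.toRingHom_apply _ _ _ _).symm
      _ = prodPairs ((MulSemiringAction.toRingHom (absoluteGaloisGroup K) (AlgebraicClosure K) σ) ∘ y) :=
          map_prodPairs _ y
      _ = prodPairs (y ∘ π) := by rw [hy]
      _ = (Equiv.Perm.sign π : ℤ) * prodPairs y := prodPairs_comp_perm y π
      _ = prodPairs y := by rw [hπ, Units.val_one, Int.cast_one, one_mul]
  -- hence `δ ∈ K`
  obtain ⟨d, hd⟩ : prodPairs y ∈ Set.range (algebraMap K (AlgebraicClosure K)) := by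
    rw [InfiniteGalois.mem_range_algebraMap_iff_fixed]
    intro τ
    exact hfix ((Field.absoluteGaloisGroup.toAlgEquiv K).symm τ)
  -- `disc f = lc⁶ δ² = (lc³ d)²`
  have hdisc := FreeSeedSmoothRt.cast_discr_eq hgen
  refine ⟨((f.leadingCoeff : ℤ) : K) ^ 3 * d, ?_⟩
  apply (algebraMap K (AlgebraicClosure K)).injective
  rw [map_intCast, hdisc]
  simp only [map_mul, map_pow, map_intCast, hd]
  simp only [prodPairs]
  ring

/-- **Some `σ ∈ Γ_K` permutes the roots oddly** when `disc f ∉ ℚ² ∪ (−3)ℚ²`. -/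
theorem exists_sign_ne_one (hD : ¬ IsSquare (f.map (Int.castRingHom ℚ)).discr)
    (hD3 : ¬ IsSquare ((-3 : ℚ) * (f.map (Int.castRingHom ℚ)).discr)) :
    ∃ σ : absoluteGaloisGroup K,
      Equiv.Perm.sign (MulAction.toPermHom (absoluteGaloisGroup K) (Roots f) σ) ≠ 1 := by
  by_contra! h
  have hsq := isSquare_discr_of_forall_sign_eq_one hgen h
  have hdeg : 0 < f.degree := by
    rw [degree_eq_natDegree (FreeSeedSmoothRt.ne_zero_of_generic hgen), hgen.1]; norm_num
  have hdisc : (f.map (Int.castRingHom ℚ)).discr = (f.discr : ℚ) := by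
    rw [discr_map_of_injective _ (Int.castRingHom ℚ).injective_int f hdeg, eq_intCast]
  rw [hdisc] at hD hD3
  rcases isSquare_or_of_isSquare_ratCast (f.discr : ℚ) (by rwa [Rat.cast_intCast]) with h1 | h1
  exacts [hD h1, hD3 h1]

/-- **The image of `Γ_K` in `Sym(Roots f)` is everything** (`≅ S₄`): it contains `A₄`
(`alternatingGroup_le_range_toPermHom`) and an odd permutation. -/
theorem range_toPermHom_eq_top (hD : ¬ IsSquare (f.map (Int.castRingHom ℚ)).discr)
    (hD3 : ¬ IsSquare ((-3 : ℚ) * (f.map (Int.castRingHom ℚ)).discr)) :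
    (MulAction.toPermHom (absoluteGaloisGroup K) (Roots f)).range = ⊤ := by
  set T := MulAction.toPermHom (absoluteGaloisGroup K) (Roots f) with hT
  obtain ⟨σ, hσ⟩ := exists_sign_ne_one hgen hD hD3
  have hA : alternatingGroup (Roots f) ≤ T.range := FreeSeedSmoothRt.alternatingGroup_le_range_toPermHom hgen
  have hx : T σ ∈ T.range := ⟨σ, rfl⟩
  have hsx : Equiv.Perm.sign (T σ) = -1 := (Int.units_eq_one_or _).resolve_left hσ
  rw [eq_top_iff]
  rintro π -
  rcases Int.units_eq_one_or (Equiv.Perm.sign π) with h1 | h1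
  · exact hA (Equiv.Perm.mem_alternatingGroup.2 h1)
  · have hmem : π * (T σ)⁻¹ ∈ T.range :=
      hA (Equiv.Perm.mem_alternatingGroup.2 (by rw [map_mul, map_inv, h1, hsx, mul_inv_cancel]))
    have := T.range.mul_mem hmem hx
    rwa [inv_mul_cancel_right] at this

end Galois

/-! ## 3. `r̄_f^B` factors through `Sym(Roots f)`; symmetric groups have no normal subgroup of index `3` -/

/-- **`r̄_f^B` factors through `Γ_K → Sym(Roots f)`**: the heart only sees the permutation action
(the factor is the heart representation of the full symmetric group of the roots in the basis `B`,
`heartRep 3 (Roots f) (Equiv.Perm (Roots f))`; the factorisation holds by `rfl`). -/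
theorem exists_rbar_eq_comp_toPermHom (f : ℤ[X]) (B : Module.Basis (Fin 3) (ZMod 3) (Heart 3 (Roots f))) :
    ∃ h : Equiv.Perm (Roots f) →* GL (Fin 3) (ZMod 3),
      rbar f B = h.comp (MulAction.toPermHom (absoluteGaloisGroup K) (Roots f)) :=
  ⟨(Units.map (LinearMap.toMatrixAlgEquiv B).toRingEquiv.toMonoidHom).comp
    (heartRep 3 (Roots f) (Equiv.Perm (Roots f))).asGroupHom, MonoidHom.ext fun _ => rfl⟩

/-- **A (finite) symmetric group has no normal subgroup of index `3`**: modulo such a subgroup every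
transposition dies (order `2` against a quotient of order `3`), and transpositions generate. -/
theorem index_ne_three_of_normal {X : Type*} [Fintype X] [DecidableEq X] (N : Subgroup (Equiv.Perm X))
    [N.Normal] : N.index ≠ 3 := by
  intro h3
  have hswap : ∀ τ : Equiv.Perm X, τ.IsSwap → τ ∈ N := by
    intro τ hτ
    obtain ⟨x, y, -, rfl⟩ := hτ
    rw [← QuotientGroup.eq_one_iff, ← orderOf_eq_one_iff]
    have h2 : orderOf (QuotientGroup.mk (s := N) (Equiv.swap x y)) ∣ 2 := by
      refine orderOf_dvd_of_pow_eq_one ?_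
      rw [← QuotientGroup.mk_pow, pow_two, Equiv.swap_mul_self, QuotientGroup.mk_one]
    have h3' : orderOf (QuotientGroup.mk (s := N) (Equiv.swap x y)) ∣ 3 := by
      rw [← h3]
      exact orderOf_dvd_natCard _
    exact Nat.dvd_one.1 (Nat.dvd_gcd h2 h3')
  have htop : N = ⊤ := by
    rw [eq_top_iff, ← Equiv.Perm.closure_isSwap, Subgroup.closure_le]
    exact fun τ hτ => hswap τ hτ
  rw [htop, Subgroup.index_top] at h3
  exact absurd h3 (by norm_num)

/-! ## 4. The registered helper -/

/-- **`rbarExtendedAdequate_of`** (registered helper of `stub_finiteOverWeights`, conditional form):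
granted the Guralnick–Herzig–Tiep theorem (tree named fact `ght2017_adequate_or_index_p_or_psl29`,
JEMS 19 (2017) Thm 1.7), for generic `f` with `disc f ∉ ℚ^{×2} ∪ (−3)ℚ^{×2}` the image of the residual
heart `r̄_f^B : Γ_K → GL₃(𝔽₃)` is adequate in the extended sense of GHT §1 = Thorne 2017 Def. 2.20.
Proof: the image is the image of `S₄` (§§ 2–3), on which GHT's alternative (b) fails (§ 3) and (c)
fails by counting (`24 < 360`); absolute irreducibility is the tree's `rbarAbsIrreducible`. -/
theorem rbarExtendedAdequate_of :
    Literature.NumberTheory.GaloisRepresentations.ght2017_adequate_or_index_p_or_psl29 →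
    ∀ (f : ℤ[X]) (B : Module.Basis (Fin 3) (ZMod 3) (Heart 3 (Roots f))), Generic f →
      ¬ IsSquare (f.map (Int.castRingHom ℚ)).discr →
      ¬ IsSquare ((-3 : ℚ) * (f.map (Int.castRingHom ℚ)).discr) →
      Subgroup.IsExtendedAdequate (rbar f B).range := by
  intro hGHT f B hgen hD hD3
  haveI : Fact (Nat.Prime 3) := ⟨Nat.prime_three⟩
  have htop := range_toPermHom_eq_top hgen hD hD3
  obtain ⟨hP, hfac⟩ := exists_rbar_eq_comp_toPermHom f B
  have hrange : (rbar f B).range = hP.range := by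
    rw [hfac, MonoidHom.range_comp, htop, ← MonoidHom.range_eq_map]
  set H : Subgroup (GL (Fin 3) (ZMod 3)) := hP.range with hH
  -- absolute irreducibility of the inclusion `H ↪ GL₃(𝔽₃)` (Burnside span form, same matrices as `r̄`)
  have hirr : IsAbsIrreducible H.subtype := by
    have hspan := FreeSeedSmoothRt.span_rbar_eq_top f hgen B
      (FreeSeedSmoothRt.alternatingGroup_le_range_toPermHom hgen)
    refine (span_eq_top_iff_forall_isIrreducible (by norm_num : 0 < 3) H.subtype).1 ?_
    have hset : (Set.range fun h : H => ((H.subtype h : GL (Fin 3) (ZMod 3)) : Matrix (Fin 3) (Fin 3) (ZMod 3))) =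
        Set.range fun g => (rbar f B g).val := by
      ext M
      simp only [Set.mem_range]
      constructor
      · rintro ⟨⟨x, hx⟩, rfl⟩
        rw [← hrange] at hx
        obtain ⟨g, rfl⟩ := hx
        exact ⟨g, rfl⟩
      · rintro ⟨g, rfl⟩
        exact ⟨⟨rbar f B g, hrange ▸ ⟨g, rfl⟩⟩, rfl⟩
    rw [hset]
    exact hspan
  rcases ght_univ_zero hGHT H.subtype H.subtype_injective hirr with ha | ⟨A, hAn, -, hAi⟩ | ⟨-, hle⟩
  · rwa [Subgroup.range_subtype, ← hrange] at ha
  · exfalso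
    haveI := hAn
    refine index_ne_three_of_normal (A.comap hP.rangeRestrict) ?_
    rw [Subgroup.index_comap_of_surjective A (MonoidHom.rangeRestrict_surjective _)]
    exact hAi
  · exfalso
    have h1 : Nat.card H ≤ Nat.card (Equiv.Perm (Roots f)) :=
      Nat.card_le_card_of_surjective _ (MonoidHom.rangeRestrict_surjective hP)
    have h2 : Nat.card (Equiv.Perm (Roots f)) = 24 := by
      rw [Nat.card_eq_fintype_card, Fintype.card_perm, FreeSeedSmoothRt.card_roots hgen]; rfl
    have h3 : Nat.card ↥(alternatingGroup (Fin 6)) = 360 := by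
      rw [nat_card_alternatingGroup, Nat.card_eq_fintype_card, Fintype.card_fin]; rfl
    omega

end

end Summit.Langlands.Langlands.Cruxes.MuOrdinaryFamilyRT.ThorneMinimalLift
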